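import Literature.Probability.RandomPlanarGeometry.YangBaxterSAWUnwoundPlaquette
import Literature.Probability.RandomPlanarGeometry.YangBaxterSAWStripMonotone
import HarnessLib

/-!
# The right-angle winding of a Yang–Baxter walk modulo `2π`: the HEADING LAW

For a self-avoiding walk of the Yang–Baxter (plaquette) model drawn in the right-angle tiling (all rhombus angles
`π/2`), the total rotation is congruent modulo `2π` to the difference of the headings of its last and first arcs:
every arc turns by `0` or `±π/2`, which is the change of heading up to a multiple of `2π`, and consecutive arcs cross
their common edge in the same direction. Together with the tree's reduction of the winding at general angles to the
right-angle winding plus a boundary potential (`YBWalk.winding_eq_winding_pi_div_two_add`), this pins the winding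
of ANY walk, at any angles, up to an INTEGER multiple of `2π` — the «sector» of the walk — by its end data alone.

* `Side.headIn` / `Side.headOut` — the heading (angle of the direction of travel) of a curve entering a square face
  through a side, resp. leaving it through a side (`E ↦ 0`, `N ↦ π/2`, `W ↦ π`, `S ↦ −π/2` for leaving;
  entering through `s` = leaving through the opposite side);
* `arcTurn_pi_div_two_eq_heading` — per arc: `turn_{π/2}(s → t) = headOut t − headIn s + 2πk`, `k ∈ {−1, 0, 1}`;
* `Face.side_eq_side_opp` — two distinct faces with a common edge see it from opposite sides, whence
  `headOut_sideOut_eq_headIn_sideIn` — consecutive arcs of a walk: the heading leaving one face is the heading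
  entering the next (the list-level induction `sum_arcTurnOf_pi_div_two_eq_heading` is private plumbing);
* ★ `YBWalk.winding_pi_div_two_eq_heading` — THE HEADING LAW: for a walk with at least one arc,
  `wind_{π/2}(γ) = headOut(exit side of the last arc) − headIn(entry side of the first arc) + 2πk` for an integer `k`;
* ★ `YBWalk.winding_eq_heading_add_slantPot` — at general angles `Θ`:
  `wind_Θ(γ) = headOut(last) − headIn(first) + κ_Θ(z) − κ_Θ(a) + 2πk` (`κ_Θ` the tree's slant potential);
* ★★ `ΩG.WP_pi_div_two_eq_headIn` — SECTOR DECOMPOSITION OF THE PREFIX TURNING: for a class-`B2a` walk at ANY rooted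
  plaquette `r` whose prefix is non-empty, `WP(π/2) = headIn(z₀) − headIn(entry side of the first arc) + 2πk` with `z₀` the
  first side of `r` hit; ★★ `ΩG.WP_eq_headIn_of_W_root` — for a hole root in the `W`-normalisation (root = `W` side of `w`,
  `(w.1 − 1, w.2) ∉ D`) at every cell and every angle `θ`: `WP(θ) = headIn(z₀) + (θ − π/2)·𝟙[z₀ slanted] + 2πk`, i.e.
  `WP ∈ τ(z₀) + 2πℤ` with `τ(W) = 0`, `τ(N) = θ − π`, `τ(E) = π`, `τ(S) = θ`.

Use (venture lane «pcv-sawmu», b-step0 gen 20, HOME `DESIGN-next-g20`): for the class-`B2a` excursions of a hole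
root the prefix turning `WP` is thereby `τ(z₀) + 2π·n` with `τ` depending only on the first side `z₀` of the cell
(`0, θ − π, −π ≡ π, θ` for `z₀ = W, N, E, S` in the `W`-root frame) and an integer SECTOR `n`; the lane's turning-
rigidity theorems at the ring cells say that `n` is determined by `z₀` there, and exact enumeration shows three
sectors at the cells of the second ring. Elementary; recorded because every direction table of the lane's cell laws
factors through it (the class direction of a wound excursion is a fixed unit times `e^{−i5πn/4}`).

References: A. Glazman, I. Manolescu, arXiv:1708.00395v3, §2.1 (the winding of a walk), eq. (2.1)
[GlazmanManolescu2019]; H. Hopf, Compositio Math. 2 (1935), Nr. 2 [Hopf1935] (context: the Umlaufsatz pins the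
integer for simple closed polygons).
-/

noncomputable section

namespace Literature.Probability.RandomPlanarGeometry.SAW.YangBaxter

open Real MidEdge

/-! ## Headings -/

/-- The heading (angle of the direction of travel, counter-clockwise from East) of a curve that ENTERS a square face
through its side `s`: through `W` heading East (`0`), through `S` heading North (`π/2`), through `E` heading West (`π`),
through `N` heading South (`−π/2`). [folklore] -/
def Side.headIn : Side → ℝ
  | .W => 0
  | .E => π
  | .S => π / 2
  | .N => -(π / 2)

/-- The heading of a curve that LEAVES a square face through its side `t`: through `E` heading East (`0`), through `N`
heading North (`π/2`), through `W` heading West (`π`), through `S` heading South (`−π/2`). [folklore] -/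
def Side.headOut : Side → ℝ
  | .E => 0
  | .W => π
  | .N => π / 2
  | .S => -(π / 2)

/-- Leaving through `t` is entering the neighbour through the opposite side: `headOut t = headIn t.opp`.
[cite: GlazmanManolescu2019, §1 (the lattice of rhombi and its mid-edges)] -/
theorem Side.headOut_eq_headIn_opp (t : Side) : t.headOut = t.opp.headIn := by
  cases t <;> rfl

/-- **Per arc**: the right-angle rotation of an arc from side `s` to side `t ≠ s` is the change of heading up to a
multiple of `2π` (the multiple is `−1`, `0` or `1`). [cite: GlazmanManolescu2019, §2.1 (definition of wind(γ): the arc z_W → z_N has winding θ, z_W → z_S has winding θ − π)] -/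
theorem arcTurn_pi_div_two_eq_heading {s t : Side} (h : s ≠ t) :
    ∃ k : ℤ, (k = -1 ∨ k = 0 ∨ k = 1) ∧ arcTurn (π / 2) s t = t.headOut - s.headIn + 2 * π * k := by
  cases s <;> cases t
  case W.W => exact absurd rfl h
  case E.E => exact absurd rfl h
  case S.S => exact absurd rfl h
  case N.N => exact absurd rfl h
  case N.W => exact ⟨-1, by norm_num, by simp only [arcTurn, Side.headIn, Side.headOut]; push_cast; ring⟩
  case E.S => exact ⟨1, by norm_num, by simp only [arcTurn, Side.headIn, Side.headOut]; push_cast; ring⟩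
  all_goals exact ⟨0, by norm_num, by simp only [arcTurn, Side.headIn, Side.headOut]; push_cast; ring⟩

/-! ## Two faces along an edge see it from opposite sides -/

/-- **Two distinct faces with a common edge see it from opposite sides.**
[cite: GlazmanManolescu2019, §1 (the lattice of rhombi and its mid-edges)] -/
theorem Face.side_eq_side_opp {f g : Face} {s t : Side} {m : MidEdge} (hf : f.side t = m) (hg : g.side s = m)
    (hfg : f ≠ g) : s = t.opp := by
  obtain ⟨fk, fj⟩ := f
  obtain ⟨gk, gj⟩ := g
  cases s <;> cases t <;> cases m <;>
    simp only [Face.side, MidEdge.vert.injEq, MidEdge.slant.injEq, reduceCtorEq, Side.opp, ne_eq,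
      Prod.mk.injEq, not_and] at hf hg hfg ⊢ <;> omega

/-- **Consecutive arcs cross their common edge in the same direction**: if the arc `p` (in the face `f`) ends at the
mid-edge where the arc `q` (in a different face `g`) begins, the heading leaving `f` equals the heading entering `g`.
[cite: GlazmanManolescu2019, §1 (the lattice of rhombi and its mid-edges) and §2.1 (wind(γ))] -/
theorem headOut_sideOut_eq_headIn_sideIn {p q : MidEdge × MidEdge} {f g : Face} (hp : arcFace p = some f)
    (hq : arcFace q = some g) (hfg : f ≠ g) (hpq : p.2 = q.1) :
    (sideOut p).headOut = (sideIn q).headIn := by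
  obtain ⟨-, hpo, -⟩ := side_sideIn hp
  obtain ⟨hqi, -, -⟩ := side_sideIn hq
  rw [Side.headOut_eq_headIn_opp, ← Face.side_eq_side_opp hpo (hqi.trans hpq.symm) hfg]

/-! ## The heading law -/

/-- Consecutive arcs of a mid-edge list share their middle mid-edge. [folklore] -/
private theorem arcsOf_isChain_snd_eq_fst : ∀ l : List MidEdge, (arcsOf l).IsChain fun p q => p.2 = q.1
  | [] => by simp
  | [x] => by simp
  | x :: y :: l => by
    rw [arcsOf_cons_cons]
    cases l with
    | nil => simp
    | cons u l' =>
      rw [arcsOf_cons_cons] at *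
      refine List.IsChain.cons_cons rfl ?_
      have := arcsOf_isChain_snd_eq_fst (y :: u :: l')
      rwa [arcsOf_cons_cons] at this

/-- The heading law for lists of arcs (induction form): for a non-empty list of arcs, each with a face, consecutive
ones in different faces and sharing their middle mid-edge, the sum of the right-angle rotations is
`headOut(last exit) − headIn(first entry)` up to an integer multiple of `2π`. [folklore] -/
private theorem sum_arcTurnOf_pi_div_two_eq_heading :
    ∀ (l : List (MidEdge × MidEdge)) (hl : l ≠ []), (∀ p ∈ l, ∃ f, arcFace p = some f) →
      l.IsChain (fun p q => arcFace p ≠ arcFace q) → l.IsChain (fun p q => p.2 = q.1) →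
      ∃ k : ℤ, (l.map (arcTurnOf fun _ => π / 2)).sum =
        (sideOut (l.getLast hl)).headOut - (sideIn (l.head hl)).headIn + 2 * π * k
  | [], hl, _, _, _ => absurd rfl hl
  | [p], _, hf, _, _ => by
    obtain ⟨f, hpf⟩ := hf p (by simp)
    obtain ⟨-, -, hne⟩ := side_sideIn hpf
    obtain ⟨k, -, hk⟩ := arcTurn_pi_div_two_eq_heading hne
    refine ⟨k, ?_⟩
    simp only [List.map_cons, List.map_nil, List.sum_cons, List.sum_nil, add_zero, List.getLast_singleton,
      List.head_cons]
    rw [arcTurnOf_eq_arcTurn hpf, hk]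
  | p :: q :: l, _, hf, hc, hc2 => by
    obtain ⟨f, hpf⟩ := hf p (by simp)
    obtain ⟨g, hqg⟩ := hf q (by simp)
    have hfg : f ≠ g := by
      intro e; subst e
      exact (List.isChain_cons_cons.1 hc).1 (by rw [hpf, hqg])
    have hpq : p.2 = q.1 := (List.isChain_cons_cons.1 hc2).1
    obtain ⟨k₁, hk₁⟩ := sum_arcTurnOf_pi_div_two_eq_heading (q :: l) (List.cons_ne_nil q l)
      (fun r hr => hf r (List.mem_cons_of_mem p hr)) (List.isChain_cons_cons.1 hc).2 (List.isChain_cons_cons.1 hc2).2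
    obtain ⟨-, -, hne⟩ := side_sideIn hpf
    obtain ⟨k₂, -, hk₂⟩ := arcTurn_pi_div_two_eq_heading hne
    have hj := headOut_sideOut_eq_headIn_sideIn hpf hqg hfg hpq
    refine ⟨k₁ + k₂, ?_⟩
    rw [List.map_cons, List.sum_cons, hk₁, arcTurnOf_eq_arcTurn hpf, hk₂, List.getLast_cons (List.cons_ne_nil q l),
      List.head_cons, List.head_cons, hj]
    push_cast
    ring

namespace YBWalk

variable {D : Set Face} {a z : MidEdge}

/-- ★ **THE HEADING LAW.** For a Yang–Baxter walk with at least one arc, the right-angle winding is the heading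
leaving the last face minus the heading entering the first face, up to an integer multiple of `2π`:
`wind_{π/2}(γ) = headOut(sideOut(last arc)) − headIn(sideIn(first arc)) + 2πk`.
[cite: GlazmanManolescu2019, §2.1, eq. (2.1) (wind(γ), the total angle of rotation)] -/
theorem winding_pi_div_two_eq_heading (γ : YBWalk D a z) (hn : γ.arcs ≠ []) :
    ∃ k : ℤ, γ.winding (fun _ => π / 2) =
      (sideOut (γ.arcs.getLast hn)).headOut - (sideIn (γ.arcs.head hn)).headIn + 2 * π * k :=
  sum_arcTurnOf_pi_div_two_eq_heading γ.arcs hn (fun p hp => by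
      obtain ⟨f, -, hf⟩ := γ.arc_mem p hp
      exact ⟨f, hf⟩)
    γ.isChain (arcsOf_isChain_snd_eq_fst γ.mids)

/-- ★ **The heading law at general angles**: `wind_Θ(γ) = headOut(last) − headIn(first) + κ_Θ(z) − κ_Θ(a) + 2πk`,
with the slant potential `κ_Θ = slantPot Θ` of the tree (`θ_k − π/2` on the slanted edges of column `k`, `0` on
vertical edges) — the winding of any walk is pinned by its end data up to an integer multiple of `2π`.
[cite: GlazmanManolescu2019, §2.1, eq. (2.1) (wind(γ))] -/
theorem winding_eq_heading_add_slantPot (Θ : ℤ → ℝ) (γ : YBWalk D a z) (hn : γ.arcs ≠ []) :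
    ∃ k : ℤ, γ.winding Θ =
      (sideOut (γ.arcs.getLast hn)).headOut - (sideIn (γ.arcs.head hn)).headIn +
        (slantPot Θ z - slantPot Θ a) + 2 * π * k := by
  obtain ⟨k, hk⟩ := γ.winding_pi_div_two_eq_heading hn
  refine ⟨k, ?_⟩
  rw [γ.winding_eq_winding_pi_div_two_add Θ, hk]
  ring

/-- The winding of a walk with at least one arc lies in a fixed residue class modulo `2π` determined by its first and
last arcs and its end edges: two walks with the same end data differ in winding by a multiple of `2π`.
[cite: GlazmanManolescu2019, §2.1, eq. (2.1) (wind(γ))] -/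
theorem winding_sub_winding_eq_int_mul (Θ : ℤ → ℝ) (γ δ : YBWalk D a z) (hγ : γ.arcs ≠ []) (hδ : δ.arcs ≠ [])
    (hfirst : sideIn (γ.arcs.head hγ) = sideIn (δ.arcs.head hδ))
    (hlast : sideOut (γ.arcs.getLast hγ) = sideOut (δ.arcs.getLast hδ)) :
    ∃ k : ℤ, γ.winding Θ - δ.winding Θ = 2 * π * k := by
  obtain ⟨k₁, h₁⟩ := γ.winding_eq_heading_add_slantPot Θ hγ
  obtain ⟨k₂, h₂⟩ := δ.winding_eq_heading_add_slantPot Θ hδ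
  refine ⟨k₁ - k₂, ?_⟩
  rw [h₁, h₂, hfirst, hlast]
  push_cast
  ring

end YBWalk

/-! ## The prefix turning of a class-`B2a` walk at any cell: sector decomposition -/

/-- The last element of a non-trivial prefix of a list. [folklore] -/
private theorem List.getLast_take_eq_getElem {α : Type*} {l : List α} {k : ℕ} (hk : k ≤ l.length) (h0 : 0 < k)
    (hne : l.take k ≠ []) : (l.take k).getLast hne = l[k - 1]'(by omega) := by
  rw [List.getLast_eq_getElem]
  simp only [List.length_take, List.getElem_take]
  congr 1
  omega

/-- The first element of a non-trivial prefix of a list. [folklore] -/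
private theorem List.head_take_eq_getElem {α : Type*} {l : List α} {k : ℕ} (hk : k ≤ l.length) (h0 : 0 < k)
    (hne : l.take k ≠ []) : (l.take k).head hne = l[0]'(by omega) := by
  rw [List.head_eq_getElem]
  simp only [List.getElem_take]

namespace ΩG

variable {D : Set Face} {a : MidEdge} {r : Face}

/-- ★★ **SECTOR DECOMPOSITION OF THE PREFIX TURNING (right angles).** For a class-`B2a` walk at a rooted plaquette `r`
whose prefix (the arcs before the first crossing of `∂r`) is non-empty: `WP(π/2) = headIn(z₀) − headIn(s₀) + 2πk`, where
`z₀` is the side of `r` first hit, `s₀` the side through which the first arc enters its face, and `k` an integer — the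
prefix ends by crossing INTO `r` through `z₀`, so its last exit heading is `headIn z₀`.
[cite: GlazmanManolescu2019, §2.1, eq. (2.1) (wind(γ)); Lemma 2.1 (proof: [Gl], the classes of walks through a rhombus)] -/
theorem WP_pi_div_two_eq_headIn (ω : ΩG D a r) (h : ω.IsB2a) (h0 : 0 < ω.2.firstHitG) :
    ∃ k : ℤ, ω.WP (fun _ => π / 2) =
      ω.2.firstSideG.headIn - (sideIn ((ω.2.arcs)[0]'(by exact lt_trans h0 (ω.fh_lt h)))).headIn + 2 * π * k := by
  have hfh := ω.fh_lt h
  set P := ω.2.take ω.2.firstHitG hfh.le with hP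
  have hParcs : P.arcs = ω.2.arcs.take ω.2.firstHitG := YBWalk.take_arcs _ _ _
  have hne : P.arcs ≠ [] := by
    rw [hParcs]; intro e
    have := congrArg List.length e
    rw [List.length_take, List.length_nil] at this
    omega
  obtain ⟨k, hk⟩ := P.winding_pi_div_two_eq_heading hne
  have hwind : P.winding (fun _ => π / 2) = ω.WP (fun _ => π / 2) := by
    unfold YBWalk.winding ΩG.WP; rw [hParcs]
  -- the last prefix arc: `arcs[fh - 1] = (nth (fh-1), nth fh)`, in a face `f ≠ r`, exiting through `nth fh = r.side z₀`
  have hlast : P.arcs.getLast hne = (ω.2.arcs)[ω.2.firstHitG - 1]'(by omega) := by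
    simp only [hParcs]
    exact List.getLast_take_eq_getElem hfh.le h0 _
  have hhead : P.arcs.head hne = (ω.2.arcs)[0]'(by omega) := by
    simp only [hParcs]
    exact List.head_take_eq_getElem hfh.le h0 _
  have hidx : ω.2.firstHitG - 1 + 1 = ω.2.firstHitG := by omega
  have harc : (ω.2.arcs)[ω.2.firstHitG - 1]'(by omega) = (ω.2.nth (ω.2.firstHitG - 1), ω.2.nth ω.2.firstHitG) := by
    rw [ω.2.arcs_getElem_eq_nth, hidx]
  have hlen : ω.2.firstHitG - 1 < ω.2.arcs.length := by omega
  obtain ⟨f, -, hf⟩ := ω.2.arc_mem _ (List.getElem_mem hlen)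
  have hfr : f ≠ r := by
    intro e; subst e
    have := ω.2.arcFace_ne_of_lt_firstHitG (i := ω.2.firstHitG - 1) (by omega) (by omega)
    rw [hidx, ← harc] at this
    exact this hf
  obtain ⟨-, hout, -⟩ := side_sideIn hf
  have hm : ((ω.2.arcs)[ω.2.firstHitG - 1]'(by omega)).2 = r.side ω.2.firstSideG := by
    rw [harc]; exact ω.2.nth_firstHitG
  have hopp := Face.side_eq_side_opp hout hm.symm hfr
  refine ⟨k, ?_⟩
  rw [← hwind, hk, hlast, hhead, Side.headOut_eq_headIn_opp, ← hopp]

/-- ★★ **THE PREFIX TURNING OF A HOLE ROOT IN THE `W`-NORMALISATION, AT ANY CELL AND ANY ANGLE.** Root = the `W` side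
of `w`, the plaquette `(w.1 − 1, w.2)` across it not in the domain (so the first arc enters `w` through `W`, heading
East): for every class-`B2a` walk at every rooted plaquette `r` with non-empty prefix,
`WP(θ) = headIn(z₀) + (θ − π/2)·𝟙[z₀ ∈ {S, N}] + 2πk` — the prefix turning lies in the class `τ(z₀) + 2πℤ` with
`τ(W) = 0`, `τ(E) = π`, `τ(S) = θ`, `τ(N) = θ − π`; the integer `k` is the SECTOR of the walk.
[cite: GlazmanManolescu2019, §2.1, eq. (2.1) (wind(γ)); Lemma 2.1 (proof: [Gl])] -/
theorem WP_eq_headIn_of_W_root {w : Face} (hh : ((w.1 - 1, w.2) : Face) ∉ D) (ω : ΩG D (w.side .W) r)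
    (h : ω.IsB2a) (h0 : 0 < ω.2.firstHitG) (θ : ℝ) :
    ∃ k : ℤ, ω.WP (fun _ => θ) = ω.2.firstSideG.headIn + (θ - π / 2) * ω.2.firstSideG.slantInd + 2 * π * k := by
  have hfh := ω.fh_lt h
  obtain ⟨k, hk⟩ := ω.WP_pi_div_two_eq_headIn h h0
  -- the first arc lies in `w` and enters through `W`
  have harc0 : (ω.2.arcs)[0]'(by omega) = (w.side .W, ω.2.nth 1) := by
    rw [ω.2.arcs_getElem_eq_nth, ω.2.nth_zero]
  have hlen0 : 0 < ω.2.arcs.length := lt_trans h0 hfh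
  obtain ⟨f, hfD, hf⟩ := ω.2.arc_mem _ (List.getElem_mem hlen0)
  obtain ⟨hin, -, -⟩ := side_sideIn hf
  have h1 : ((ω.2.arcs)[0]'(by omega)).1 = w.side .W := by rw [harc0]
  have hin' : f.side (sideIn ((ω.2.arcs)[0]'(by omega))) = w.side .W := hin.trans h1
  -- `f` borders `w.side W = vert w.1 w.2`: it is `w` or `(w.1-1, w.2)`; the latter is excluded
  have hfw : f = w := by
    have hc := (Face.exists_side_eq_iff f (w.side .W)).1 ⟨_, hin'⟩
    simp only [Face.side, MidEdge.faces] at hc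
    rcases hc with hc | hc
    · exact absurd (hc ▸ hfD) hh
    · exact hc.trans Prod.mk.eta
  subst hfw
  have hW : sideIn ((ω.2.arcs)[0]'(by omega)) = .W := Face.side_injective f hin'
  -- transfer to the angle `θ`
  set P := ω.2.take ω.2.firstHitG hfh.le with hP
  have hParcs : P.arcs = ω.2.arcs.take ω.2.firstHitG := YBWalk.take_arcs _ _ _
  have hwθ : P.winding (fun _ => θ) = ω.WP (fun _ => θ) := by unfold YBWalk.winding ΩG.WP; rw [hParcs]
  have hw2 : P.winding (fun _ => π / 2) = ω.WP (fun _ => π / 2) := by unfold YBWalk.winding ΩG.WP; rw [hParcs]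
  have htr := P.winding_eq_winding_pi_div_two_add (fun _ => θ)
  rw [hwθ, hw2, ω.2.nth_firstHitG, slantPot_side, slantPot_side] at htr
  refine ⟨k, ?_⟩
  rw [htr, hk, hW]
  simp [Side.headIn, Side.slantInd]
  ring

end ΩG

end Literature.Probability.RandomPlanarGeometry.SAW.YangBaxter

end
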